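import Summits.BirchSwinnertonDyer.BirchSwinnertonDyer.Theorems.KimAtThreeFineKatoLimitLogPadic
import Summits.BirchSwinnertonDyer.Rank1Residual.X11b.RouteR1LogOmega
import Literature.NumberTheory.EllipticCurves.PadicLogFiniteExtension
import HarnessLib
import HarnessLib.Audit.Tags

/-!
# Route `SchneiderFreeAdditiveX3` (K1 door), crux `GordTwoBranchIMC` (stmt-BirchSwinnertonDyer-19177):
# BRIDGE — the receptacle's `logOmega` IS the Literature `padicLogPointFiniteExt`, over `ℚ_p` and read
# in any complete extension `F ⊇ ℚ_p` (e.g. `ℂ_p`); integrality and discriminant of the minimal model in `F`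

Cell `bsd-schneider-ideate` (HOME `run/shared/lean/pub/bsd-schneider-ideate/`), seat `door-c3` gen 10.
PARTITION: board row B6 ∩ X3 ∩ sst-twist, r = 1, (G-ord, `e = 2`) half (2 560 of 7 101 pairs) of
`Rank1Residual.partition`; plumbing for the twist descent of the logarithm in crux r3's last untyped input
`KYRead.KYReadCHValue` (sibling `…KYReadLogDescent.lean`); closes nothing (BSD is not advanced).

* `logOmega_eq_padicLogPointFiniteExt` — `X11b.Halves.logOmega W p ι P` (the door receptacle's
  `log_{ω_E} P = log_Ê([m₀]P_ι)/m₀ ∈ ℚ_p`) equals `FormalGroupChart.padicLogPointFiniteExt ‖·‖ (W ⊗ ℚ_p) p P_ι`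
  (definition item `defn-padicLogPointFiniteExt`, p495646) — via `R1.logOmega_eq_padicLog`,
  `KimAtThreeFineKatoLimitLogPadic.padicLog_eq_limitLog_smul_div`, `padicLogPointFiniteExt_eq_div`;
* `map_logOmega_eq_padicLogPointFiniteExt` — along an isometric `e : ℚ_p → F` into a complete
  nonarchimedean `F` (MEANT `F = ℂ_p`, `e = algebraMap`, `PadicComplex.norm_extends'`):
  `e(logOmega W p ι P) = padicLogPointFiniteExt ‖·‖ (W ⊗ F) p (e_* P_ι)` and `m₀ • e_* P_ι` lies in the
  level `E⁽ᵖ⁾(F)`, `m₀ = formalIndex W p > 0`;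
* `isIntegral_valuation_baseChange` (a globally minimal `W/ℚ` is `‖·‖`-integral over every
  nonarchimedean normed field of characteristic `0`), `norm_Δ_baseChange` (`‖Δ_W‖ ≤ 1`, `= 1` if
  `p ∤ Δ_W`), `natCast_ne_zero_and_val_lt_one_{padic,of_isometry}`, `val_map_eq_of_isometry`.

`F` is kept GENERIC (universe `Type`, as `ℚ_[p]`, for the Literature functoriality lemma): statements
written directly over `ℂ_[p]` time out in the kernel (instance tower of `Completion (AlgebraicClosure ℚ_p)`).
HONEST FRAMING: plumbing; nothing about `L`-functions. Theses-free.

References: Silverman *AEC* IV.6.4, VII.1, VII.2.2, VII.6.3, VIII.8; Castella, Camb. J. Math. 6 (2018)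
§2.2 (`log_{ω_E}` on `E(K_𝔭) = E(ℚ_p)`).
-/

noncomputable section

open scoped Classical NNReal

open WeierstrassCurve NumberField IsDedekindDomain Field
  Literature.NumberTheory.EllipticCurves
  Literature.NumberTheory.EllipticCurves.FormalGroupChart
  Summit.BirchSwinnertonDyer.Rank1Residual
  Summit.BirchSwinnertonDyer.Rank1Residual.X11b
  Summit.BirchSwinnertonDyer.Rank1Residual.X11b.Halves

set_option linter.dupNamespace false
set_option autoImplicit false

namespace Summit.BirchSwinnertonDyer.BirchSwinnertonDyer.Theorems.SchneiderFree.KYRead.LogDescent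

/-! ## §2 Plumbing over `ℚ_p` and a complete extension `F ⊇ ℚ_p`: integrality, `logOmega` as
`padicLogPointFiniteExt`, the discriminant in `F` -/

section Bridge

variable (p : ℕ) [Fact p.Prime] {F : Type} [NontriviallyNormedField F] [IsUltrametricDist F]
  (e : ℚ_[p] →+* F) (he : ∀ x, ‖e x‖ = ‖x‖)

/-- `0 < ‖p‖ < 1` in `ℚ_p`, valuation language. [folklore] -/
theorem natCast_ne_zero_and_val_lt_one_padic :
    (p : ℚ_[p]) ≠ 0 ∧ NormedField.valuation (p : ℚ_[p]) < 1 := by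
  refine ⟨Nat.cast_ne_zero.mpr (Fact.out : p.Prime).ne_zero, ?_⟩
  rw [NormedField.valuation_apply, ← NNReal.coe_lt_coe, coe_nnnorm, NNReal.coe_one, Padic.norm_p]
  exact inv_lt_one_of_one_lt₀ (by exact_mod_cast (Fact.out : p.Prime).one_lt)

include he in
/-- `0 < ‖p‖ < 1` in an extension `F ⊇ ℚ_p` with isometric structure map. [folklore] -/
theorem natCast_ne_zero_and_val_lt_one_of_isometry :
    (p : F) ≠ 0 ∧ NormedField.valuation (p : F) < 1 := by
  have hpe : (p : F) = e (p : ℚ_[p]) := by rw [map_natCast]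
  refine ⟨by rw [hpe, map_ne_zero]; exact Nat.cast_ne_zero.mpr (Fact.out : p.Prime).ne_zero, ?_⟩
  rw [NormedField.valuation_apply, ← NNReal.coe_lt_coe, coe_nnnorm, NNReal.coe_one, hpe, he,
    Padic.norm_p]
  exact inv_lt_one_of_one_lt₀ (by exact_mod_cast (Fact.out : p.Prime).one_lt)

include he in
/-- An isometric ring map `ℚ_p → F` is an isometry in valuation language. [folklore] -/
theorem val_map_eq_of_isometry (x : ℚ_[p]) :
    NormedField.valuation (e x) = NormedField.valuation x := by
  rw [NormedField.valuation_apply, NormedField.valuation_apply]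
  ext
  rw [coe_nnnorm, coe_nnnorm]
  exact he x

variable (W : WeierstrassCurve ℚ) [W.IsGloballyMinimal]

/-- A globally minimal `W/ℚ` is `‖·‖`-integral over any nonarchimedean normed field of
characteristic `0` (its `ℤ`-model base-changed). [cite: SilvermanAEC2009, VII.1 and VIII.8 (integral / global minimal equations)] -/
theorem isIntegral_valuation_baseChange (F' : Type*) [NormedField F'] [IsUltrametricDist F']
    [CharZero F'] : (W.baseChange F').IsIntegral (NormedField.valuation (K := F')).integer := by
  have h := isIntegral_valuation_baseChange_int (K := F') (integralModelInt W)
  have e' : (integralModelInt W).baseChange F' = W.baseChange F' := by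
    conv_rhs => rw [← map_integralModelInt W]
    rw [WeierstrassCurve.baseChange, WeierstrassCurve.baseChange, WeierstrassCurve.map_map]
    congr 1
    exact Subsingleton.elim _ _
  rwa [e'] at h

omit [IsUltrametricDist F] in
include he in
/-- `‖Δ_W‖ ≤ 1` in `F` for a globally minimal `W`, and `= 1` when `p ∤ Δ_W`. [folklore] -/
theorem norm_Δ_baseChange [CharZero F] :
    ‖(W.baseChange F).Δ‖ ≤ 1 ∧ (¬ (p : ℤ) ∣ minimalDiscriminantInt W → ‖(W.baseChange F).Δ‖ = 1) := by
  have eΔ : (W.baseChange F).Δ = e ((minimalDiscriminantInt W : ℤ) : ℚ_[p]) := by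
    rw [WeierstrassCurve.baseChange, WeierstrassCurve.map_Δ, ← cast_minimalDiscriminantInt, map_intCast,
      map_intCast]
  have en : ‖(W.baseChange F).Δ‖ = ‖((minimalDiscriminantInt W : ℤ) : ℚ_[p])‖ := by rw [eΔ, he]
  refine ⟨by rw [en]; exact Padic.norm_int_le_one _, fun h ↦ ?_⟩
  rw [en]
  exact le_antisymm (Padic.norm_int_le_one _) (not_lt.mp (mt Padic.norm_intCast_lt_one_iff.mp h))

variable [W.IsElliptic] {K : Type} [Field K] [NumberField K]
  (ι : K →+* ℚ_[p]) (P : (W.baseChange K).toAffine.Point)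

/-- **`logOmega` is `padicLogPointFiniteExt` over `ℚ_p`**: the receptacle's `log_{ω_E} P =
log_Ê([m₀]P_ι)/m₀` is the limit-logarithm extension `ℓ_p(m₀ • P_ι)/m₀` of the Literature layer
(`R1.logOmega_eq_padicLog`, `padicLog_eq_limitLog_smul_div`, `padicLogPointFiniteExt_eq_div`).
[cite: SilvermanAEC2009, Thm. IV.6.4 and Prop. VII.6.3] -/
theorem logOmega_eq_padicLogPointFiniteExt :
    haveI := isIntegral_valuationInteger_of_isIntegral_padicInt (W.baseChange ℚ_[p])
    logOmega W p ι P =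
      padicLogPointFiniteExt NormedField.valuation (W.baseChange ℚ_[p]) p (X11b.padicPointOf W p ι P) := by
  haveI := isIntegral_valuationInteger_of_isIntegral_padicInt (W.baseChange ℚ_[p])
  obtain ⟨hp0, hp1⟩ := natCast_ne_zero_and_val_lt_one_padic p
  set X := W.baseChange ℚ_[p] with hX
  have hm : X.IsInReductionKernel (X11b.formalIndex W p • X11b.padicPointOf W p ι P) :=
    (X11b.formalIndex_smul_mem W p (X11b.padicPointOf W p ι P)).1
  have hmK : X11b.formalIndex W p • X11b.padicPointOf W p ι P ∈ kernel NormedField.valuation X :=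
    (mem_kernel_iff_isInReductionKernel X _).mpr hm
  have hmL : X11b.formalIndex W p • X11b.padicPointOf W p ι P ∈
      level NormedField.valuation X (NormedField.valuation (p : ℚ_[p])) := by
    rw [level_padic_eq_kernel]; exact hmK
  have hn : X11b.formalIndex W p ≠ 0 := by
    haveI := (W.baseChange ℚ_[p]).finiteIndex_formalFiltration 1
    exact AddSubgroup.FiniteIndex.index_ne_zero
  have hℓ := limitLog_spec_of_completeSpace (V := X) hp0 hp1
  have hℓK : ∀ Q ∈ kernel NormedField.valuation X, ∀ r : ℕ,
      NormedField.valuation (limitLog NormedField.valuation X p Q - ((p ^ r) • Q).zCoord / (p : ℚ_[p]) ^ r)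
        ≤ NormedField.valuation (p : ℚ_[p]) ^ (r + 1) := fun Q hQ ↦ hℓ Q (by
    rw [level_padic_eq_kernel]; exact hQ)
  rw [R1.logOmega_eq_padicLog, KimAtThreeFineKatoLimitLogPadic.padicLog_eq_limitLog_smul_div hℓK hn hmK,
    padicLogPointFiniteExt_eq_div hp0 hp1 hℓ (Nat.pos_of_ne_zero hn) hmL]

include he in
/-- **`logOmega` read in a complete extension `F ⊇ ℚ_p` (e.g. `ℂ_p`)**: the image of `log_{ω_E} P ∈
ℚ_p` in `F` is the `F`-valued logarithm of the image point (functoriality of `padicLogPointFiniteExt`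
along the isometric embedding `e`), and that image point has a positive multiple in the level `E⁽ᵖ⁾(F)`.
[cite: SilvermanAEC2009, Thm. IV.6.4 with Prop. VII.2.2] -/
theorem map_logOmega_eq_padicLogPointFiniteExt [CompleteSpace F] [CharZero F] :
    haveI := isIntegral_valuation_baseChange W F
    e (logOmega W p ι P) =
      padicLogPointFiniteExt NormedField.valuation (W.baseChange F) p
        (WeierstrassCurve.Affine.Point.map e.toRatAlgHom (X11b.padicPointOf W p ι P)) ∧
    (X11b.formalIndex W p) • WeierstrassCurve.Affine.Point.map e.toRatAlgHom
        (X11b.padicPointOf W p ι P) ∈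
      level NormedField.valuation (W.baseChange F) (NormedField.valuation (p : F)) ∧
    0 < X11b.formalIndex W p := by
  haveI := isIntegral_valuationInteger_of_isIntegral_padicInt (W.baseChange ℚ_[p])
  haveI := isIntegral_valuation_baseChange W F
  obtain ⟨hp0, hp1⟩ := natCast_ne_zero_and_val_lt_one_padic p
  obtain ⟨hp0', hp1'⟩ := natCast_ne_zero_and_val_lt_one_of_isometry p e he
  set X := W.baseChange ℚ_[p] with hX
  have hm : X.IsInReductionKernel (X11b.formalIndex W p • X11b.padicPointOf W p ι P) :=
    (X11b.formalIndex_smul_mem W p (X11b.padicPointOf W p ι P)).1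
  have hmL : X11b.formalIndex W p • X11b.padicPointOf W p ι P ∈
      level NormedField.valuation X (NormedField.valuation (p : ℚ_[p])) := by
    rw [level_padic_eq_kernel]; exact (mem_kernel_iff_isInReductionKernel X _).mpr hm
  have hn : 0 < X11b.formalIndex W p := by
    haveI := (W.baseChange ℚ_[p]).finiteIndex_formalFiltration 1
    exact Nat.pos_of_ne_zero AddSubgroup.FiniteIndex.index_ne_zero
  have hι : ∀ x, NormedField.valuation (e.toRatAlgHom x) = NormedField.valuation x :=
    fun x ↦ val_map_eq_of_isometry p e he x
  refine ⟨?_, ?_, hn⟩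
  · rw [logOmega_eq_padicLogPointFiniteExt]
    exact (padicLogPointFiniteExt_map_of_val_eq (X := W) hp0 hp1
      (limitLog_spec_of_completeSpace hp0 hp1) (limitLog_spec_of_completeSpace hp0' hp1') hι hn hmL).symm
  · rw [← map_nsmul]
    exact map_mem_level_of_val_eq hι hmL

end Bridge

end Summit.BirchSwinnertonDyer.BirchSwinnertonDyer.Theorems.SchneiderFree.KYRead.LogDescent

end
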